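import Literature.AlgebraicGeometry.AbelianSchemes.SerreTensorComposition
import Literature.AlgebraicGeometry.AbelianSchemes.SerreTensorPresentation
import HarnessLib

/-!
# Reindexing a presentation and the symmetry `A ⊗_𝒪 (𝔞 ⊗ 𝔟) ≅ A ⊗_𝒪 (𝔟 ⊗ 𝔞)` of Serre's tensor construction

Topic `AlgebraicGeometry/AbelianSchemes`, namespace `Literature.AlgebraicGeometry.AbelianSchemes.AbelianSchemeOver` (constructions with
bodies + proved theorems; no named fact, no `sorry`, no `instance`, no notation; any base `S`).  Cell `hodgecm-mathlib`, F0/P6 «MOD»,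
P6a organ (g2) FILE 8 (FILE 5 ★ `SerreTensorPresentation`, FILE 6b `SerreTensorComposition`); `--supports stmt-HodgeConjecture-24832`,
count-neutral.  HC_CM is proved only modulo the 2 remaining named inputs (hLiu418, h413) until rung 0 closes; this file discharges none.

## Mathematics

Renumbering the generators of a presentation `𝔞 = E·𝒪ⁿ` along a bijection `τ : Fin n ≃ Fin n′` gives the presentation
`E^τ = reindex τ τ E` of the same module; the two are intertwined by the pair `P = E.submatrix τ⁻¹ id`, `Q = E.submatrix id τ⁻¹`
(`Q P = E² = E`, `P Q = (E²)^τ = E^τ`), so FILE 5's presentation independence yields a canonical `𝒪`-equivariant isomorphism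
`Fix([E]) ≅ Fix([E^τ])`.  For the Kronecker presentations of FILE 6b, the swap `Fin m × Fin n ≃ Fin n × Fin m` carries `F ⊗ₖ E` to
`E ⊗ₖ F` (commutativity of `𝒪`), whence the symmetry `A ⊗_𝒪 (𝔞 ⊗ 𝔟) ≅ A ⊗_𝒪 (𝔟 ⊗ 𝔞)` (B. Conrad, *Gross–Zagier revisited* §7:
`M ⊗_𝒪 A` is functorial in `M`, so the symmetry of `⊗` over the commutative ring `𝒪` transports).

## Contents

* §1 `reindexP E τ`, `reindexQ E τ`, `reindexQ_mul_reindexP : Q * P = E` (for `E² = E`), `reindexP_mul_reindexQ : P * Q = reindex τ τ E`,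
  `reindex_idem`, **`serreReindexIso act E hE τ : (serreTensor act E hE).X ≅ (serreTensor act (reindex τ τ E) _).X`**, `isMonHom_serreReindexIso`,
  `serreReindexIso_equivariant`;
* §2 `kronSwap m n : Fin (m*n) ≃ Fin (n*m)`, `reindex_kronSwap_kronPres : reindex (kronSwap m n) (kronSwap m n) (kronPres E F) = kronPres F E`,
  **`serreTensorSymmIso act E hE F hF : (serreTensor act (kronPres E F) _).X ≅ (serreTensor act (kronPres F E) _).X`**,
  `isMonHom_serreTensorSymmIso`, `serreTensorSymmIso_equivariant`.

## References
* [Conrad2004GrossZagier] B. Conrad, *Gross–Zagier revisited*, MSRI Publ. 49 (2004), §7.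
* [Kottwitz1992] §5 (p. 390).
* Tree: ★ FILE 5 `SerreTensorPresentation` (`serrePresentationIso`), FILE 6b `SerreTensorComposition` (`kronPres`).
-/

noncomputable section

universe u

open CategoryTheory CategoryTheory.Limits AlgebraicGeometry MonoidalCategory CartesianMonoidalCategory
open scoped MonObj Kronecker

namespace Literature.AlgebraicGeometry.AbelianSchemes

namespace AbelianSchemeOver

variable {S : Scheme.{u}} {A : AbelianSchemeOver S} {O : Type*} [CommRing O] (act : A.RingAction O) [IsCommMonObj A.X]

/-! ## §1 Reindexing a presentation along `τ : Fin n ≃ Fin n′` -/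

section Reindex

variable {n n' : ℕ} (E : Matrix (Fin n) (Fin n) O) (hE : E * E = E) (τ : Fin n ≃ Fin n')

/-- The intertwiner `P = E.submatrix τ⁻¹ id : 𝒪ⁿ → 𝒪^{n′}` from the presentation `E` to the reindexed one. [cite: Conrad2004GrossZagier, §7] -/
def reindexP : Matrix (Fin n') (Fin n) O := E.submatrix τ.symm id

/-- The intertwiner `Q = E.submatrix id τ⁻¹ : 𝒪^{n′} → 𝒪ⁿ` back. [cite: Conrad2004GrossZagier, §7] -/
def reindexQ : Matrix (Fin n) (Fin n') O := E.submatrix id τ.symm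

include hE in
/-- `Q P = E`. [cite: Conrad2004GrossZagier, §7] -/
theorem reindexQ_mul_reindexP : reindexQ E τ * reindexP E τ = E := by
  unfold reindexQ reindexP
  rw [Matrix.submatrix_mul_equiv E E id τ.symm id, hE, Matrix.submatrix_id_id]

include hE in
/-- `P Q = E^τ := reindex τ τ E`. [cite: Conrad2004GrossZagier, §7] -/
theorem reindexP_mul_reindexQ : reindexP E τ * reindexQ E τ = Matrix.reindex τ τ E := by
  unfold reindexQ reindexP
  rw [← Matrix.submatrix_mul E E τ.symm id τ.symm Function.bijective_id, hE, Matrix.reindex_apply]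

include hE in
/-- `E^τ` is idempotent. [cite: Conrad2004GrossZagier, §7] -/
theorem reindex_idem : Matrix.reindex τ τ E * Matrix.reindex τ τ E = Matrix.reindex τ τ E := by
  rw [Matrix.reindex_apply, Matrix.submatrix_mul_equiv E E τ.symm τ.symm τ.symm, hE]

/-- **`Fix([E]) ≅ Fix([E^τ])`**: renumbering the generators of the presentation does not change `A ⊗_𝒪 𝔞`.
[cite: Conrad2004GrossZagier, §7] -/
def serreReindexIso : (serreTensor act E hE).X ≅ (serreTensor act (Matrix.reindex τ τ E) (reindex_idem E hE τ)).X :=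
  serrePresentationIso act E hE (Matrix.reindex τ τ E) (reindex_idem E hE τ) (reindexP E τ) (reindexQ E τ)
    (reindexQ_mul_reindexP E hE τ) (reindexP_mul_reindexQ E hE τ)

/-- Both directions of `serreReindexIso` are homomorphisms. [cite: Conrad2004GrossZagier, §7] -/
theorem isMonHom_serreReindexIso : IsMonHom (serreReindexIso act E hE τ).hom ∧ IsMonHom (serreReindexIso act E hE τ).inv :=
  ⟨isMonHom_serrePresentationHom act E hE _ _ _, isMonHom_serrePresentationHom act _ _ E hE _⟩

/-- `serreReindexIso` is `𝒪`-equivariant. [cite: Conrad2004GrossZagier, §7] -/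
theorem serreReindexIso_equivariant (a : O) :
    (serreAction act E hE).i a ≫ (serreReindexIso act E hE τ).hom =
      (serreReindexIso act E hE τ).hom ≫ (serreAction act (Matrix.reindex τ τ E) (reindex_idem E hE τ)).i a :=
  serreAction_comp_serrePresentationHom act E hE _ _ _ _ (reindexQ_mul_reindexP E hE τ) (reindexP_mul_reindexQ E hE τ) a

end Reindex

/-! ## §2 The Kronecker swap and the symmetry `A ⊗_𝒪 (𝔞 ⊗ 𝔟) ≅ A ⊗_𝒪 (𝔟 ⊗ 𝔞)` -/

section Symm

variable (m n : ℕ)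

/-- The swap `Fin (m·n) ≃ Fin (n·m)`, `(i, k) ↦ (k, i)` on index pairs. [cite: Conrad2004GrossZagier, §7] -/
def kronSwap : Fin (m * n) ≃ Fin (n * m) := finProdFinEquiv.symm.trans ((Equiv.prodComm (Fin m) (Fin n)).trans finProdFinEquiv)

/-- `kronSwap (i, k) = (k, i)`. [cite: Conrad2004GrossZagier, §7] -/
@[simp] theorem kronSwap_apply (i : Fin m) (k : Fin n) : kronSwap m n (finProdFinEquiv (i, k)) = finProdFinEquiv (k, i) := by
  simp [kronSwap]

/-- `(kronSwap m n)⁻¹ (k, i) = (i, k)`. [cite: Conrad2004GrossZagier, §7] -/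
@[simp] theorem kronSwap_symm_apply (i : Fin m) (k : Fin n) : (kronSwap m n).symm (finProdFinEquiv (k, i)) = finProdFinEquiv (i, k) := by
  rw [Equiv.symm_apply_eq, kronSwap_apply]

variable {m n} (E : Matrix (Fin n) (Fin n) O) (hE : E * E = E) (F : Matrix (Fin m) (Fin m) O) (hF : F * F = F)

/-- The swap carries `F ⊗ₖ E` to `E ⊗ₖ F`: `(kronPres E F)^{swap} = kronPres F E`. [cite: Conrad2004GrossZagier, §7] -/
theorem reindex_kronSwap_kronPres : Matrix.reindex (kronSwap m n) (kronSwap m n) (kronPres E F) = kronPres F E := by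
  ext x y
  obtain ⟨⟨k, i⟩, rfl⟩ := finProdFinEquiv.surjective x
  obtain ⟨⟨k', j⟩, rfl⟩ := finProdFinEquiv.surjective y
  rw [Matrix.reindex_apply, Matrix.submatrix_apply, kronSwap_symm_apply, kronSwap_symm_apply, kronPres_apply, kronPres_apply, mul_comm]

/-- **`A ⊗_𝒪 (𝔞 ⊗ 𝔟) ≅ A ⊗_𝒪 (𝔟 ⊗ 𝔞)`** (Kronecker presentations `F ⊗ₖ E` and `E ⊗ₖ F`). [cite: Conrad2004GrossZagier, §7] -/
def serreTensorSymmIso :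
    (serreTensor act (kronPres E F) (kronPres_idem E hE F hF)).X ≅ (serreTensor act (kronPres F E) (kronPres_idem F hF E hE)).X :=
  serrePresentationIso act (kronPres E F) (kronPres_idem E hE F hF) (kronPres F E) (kronPres_idem F hF E hE)
    (reindexP (kronPres E F) (kronSwap m n)) (reindexQ (kronPres E F) (kronSwap m n))
    (reindexQ_mul_reindexP (kronPres E F) (kronPres_idem E hE F hF) (kronSwap m n))
    (by rw [reindexP_mul_reindexQ (kronPres E F) (kronPres_idem E hE F hF), reindex_kronSwap_kronPres])

/-- Both directions of the symmetry are homomorphisms. [cite: Conrad2004GrossZagier, §7] -/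
theorem isMonHom_serreTensorSymmIso :
    IsMonHom (serreTensorSymmIso act E hE F hF).hom ∧ IsMonHom (serreTensorSymmIso act E hE F hF).inv :=
  ⟨isMonHom_serrePresentationHom act _ _ _ _ _, isMonHom_serrePresentationHom act _ _ _ _ _⟩

/-- The symmetry is `𝒪`-equivariant. [cite: Conrad2004GrossZagier, §7] -/
theorem serreTensorSymmIso_equivariant (a : O) :
    (serreAction act (kronPres E F) (kronPres_idem E hE F hF)).i a ≫ (serreTensorSymmIso act E hE F hF).hom =
      (serreTensorSymmIso act E hE F hF).hom ≫ (serreAction act (kronPres F E) (kronPres_idem F hF E hE)).i a :=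
  serreAction_comp_serrePresentationHom act _ _ _ _ _ _
    (reindexQ_mul_reindexP (kronPres E F) (kronPres_idem E hE F hF) (kronSwap m n))
    (by rw [reindexP_mul_reindexQ (kronPres E F) (kronPres_idem E hE F hF), reindex_kronSwap_kronPres]) a

end Symm

end AbelianSchemeOver

end Literature.AlgebraicGeometry.AbelianSchemes

end
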